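import Literature.Geometry.Lorentzian.KerrCombinedCurrent
import HarnessLib

/-!
# The combined current with a corrector `G|u|²` (for the `ϟ^{ỹ}` current of the near-stationary
# subrange, DRSR Prop. 8.7.3)

(family `gr`, infrastructure for statement **gr.S24**; namespace `Literature.Geometry.Lorentzian.Kerr`)

In the proof of Proposition 8.7.3 of Dafermos–Rodnianski–Shlapentokh-Rothman (*Decay for
solutions of the wave equation on Kerr exterior spacetimes III*, arXiv:1402.7034 = Ann. of Math.
183 (2016)) the current `ϟ^{ỹ}` with `ỹ = −exp(−C∫υ)` produces the bulk
`ỹ'|u'|² + (ỹ'ω₀² − (ỹṼ)')|u|²`, and the term `(ỹṼ)'|u|²` "which threatens to destroy our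
estimate" is controlled only after an integration by parts,
`|∫(ỹṼ)'|u|²| = 2|∫ ỹṼ Re(u'ū)| ≤ ε∫ỹ'|u'|² + Bε⁻¹∫ ỹ'ω₀² (ỹ²Ṽ²/((ỹ')²ω₀²))|u|²` ((smallOmegaFirst)–
(smallOmegaSecond)). The abstract deduction "bulk ≥ 0 pointwise ⇒ estimate" of
`KerrCombinedCurrent.combined_estimate` therefore does not apply literally. This file restores a
pointwise statement by **adding the exact derivative `(G|u|²)'`, `G = ỹṼ`, to the current**:
`Q̃ = Q + G|u|²` has the bulk `bulk(Q) + G'|u|² + 2G Re(u'ū)` — for `G = ỹṼ` the `|u|²`-terms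
`−(ỹṼ)' + (ỹṼ)'` cancel and the cross term `2ỹṼ Re(u'ū)` is absorbed pointwise by
`ỹ'|u'|² + ỹ'ω₀²|u|²` once `Ṽ² ≤ C²υ²ω₀²` — and the same end values as `Q` whenever `G → 0` at
both ends (at the horizon `Ṽ → 0`, at infinity `ỹ → 0`).

* `Kerr.correctedCurrent ω ϖ E V G μ u u' = combinedCurrent … + G|u|²`,
  `Kerr.correctedBulk … = combinedBulk … + (G'|u|² + 2G⟪u, u'⟫)`;
* `Kerr.hasDerivAt_correctedCurrent` (`Q̃' = correctedBulk − combinedSource`),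
  `Kerr.tendsto_correctedCurrent_atTop/atBot` (same limits as `Q` when `G → 0`),
  `Kerr.integral_correctedBulk_eq`, `Kerr.integrable_correctedBulk_of_nonneg`,
  **`Kerr.corrected_estimate`**, **`Kerr.corrected_estimate_of_boundary_sign`** — the analogues of
  the deduction of §8.2 for `Q̃`.

No named facts (D-0026); everything is proved.

## References

* M. Dafermos, I. Rodnianski, Y. Shlapentokh-Rothman, arXiv:1402.7034 = Ann. of Math. 183 (2016),
  §8.2, §8.7.3 (proof of Prop. 8.7.3, (smallOmegaFirst)–(smallOmegaSecond))
  (key `DafermosRodnianskiShlapentokhrothman2014`).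
-/

noncomputable section

open Set Filter Topology MeasureTheory
open scoped InnerProductSpace ComplexConjugate

namespace Literature.Geometry.Lorentzian

namespace Kerr

/-! ### The corrected current and its bulk -/

/-- **The corrected current `Q̃ = Q + G|u|²`** (`Q` the combined current of `KerrCombinedCurrent`, `G`
a real weight; `G = ỹṼ` in DRSR arXiv:1402.7034, proof of Prop. 8.7.3). [cite: DafermosRodnianskiShlapentokhrothman2014, Prop. 8.7.3 (proof)] -/
def correctedCurrent (ω ϖ E : ℝ) (V G : ℝ → ℝ) (μ : Multipliers) (u u₁ : ℝ → ℂ) (x : ℝ) : ℝ :=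
  combinedCurrent ω ϖ E V μ u u₁ x + G x * ‖u x‖ ^ 2

/-- **The bulk of `Q̃'`**: `combinedBulk + (G'|u|² + 2G⟪u, u'⟫)` (`2⟪u, u'⟫_ℝ = 2Re(u'ū) = (|u|²)'`).
[cite: DafermosRodnianskiShlapentokhrothman2014, Prop. 8.7.3 (proof)] -/
def correctedBulk (ω ϖ E : ℝ) (V V' G G' : ℝ → ℝ) (μ : Multipliers) (u u₁ : ℝ → ℂ) (x : ℝ) : ℝ :=
  combinedBulk ω ϖ E V V' μ u u₁ x + (G' x * ‖u x‖ ^ 2 + 2 * G x * ⟪u x, u₁ x⟫_ℝ)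

section Derivative

variable {ω ϖ E x : ℝ} {V V' G G' : ℝ → ℝ} {μ : Multipliers} {u u₁ u₂ H : ℝ → ℂ}

/-- **`Q̃' = correctedBulk − source`** for a solution of `u'' + (ω² − V)u = H` at `x`.
[cite: DafermosRodnianskiShlapentokhrothman2014, Prop. 8.7.3 (proof)] -/
theorem hasDerivAt_correctedCurrent (hV : HasDerivAt V (V' x) x) (hG : HasDerivAt G (G' x) x)
    (hμ : μ.HasDerivs) (hu : HasDerivAt u (u₁ x) x) (hu₁ : HasDerivAt u₁ (u₂ x) x)
    (hode : u₂ x + ((ω ^ 2 - V x : ℝ) : ℂ) * u x = H x) :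
    HasDerivAt (correctedCurrent ω ϖ E V G μ u u₁)
      (correctedBulk ω ϖ E V V' G G' μ u u₁ x - combinedSource ω ϖ E μ u u₁ H x) x := by
  have hQ := hasDerivAt_combinedCurrent (ϖ := ϖ) (E := E) hV hμ hu hu₁ hode
  have hn : HasDerivAt (fun t ↦ ‖u t‖ ^ 2) (2 * ⟪u x, u₁ x⟫_ℝ) x := hu.norm_sq
  have h := hQ.add (hG.mul hn)
  unfold correctedCurrent correctedBulk
  refine h.congr_deriv ?_
  ring

end Derivative

/-! ### End values -/

section Ends

variable {ω ϖ E Atop Abot fi yi χ₁i χ₂i fh yh χ₁h χ₂h : ℝ} {V G : ℝ → ℝ} {μ : Multipliers}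
  {u u₁ : ℝ → ℂ}

/-- `Q̃(∞) = Q(∞)` when `G → 0` at `r* = ∞` (`|u|²` converges there). [folklore] -/
theorem tendsto_correctedCurrent_atTop (hl : μ.EndLimits atTop fi yi χ₁i χ₂i)
    (hb : OutgoingBoundary ω ϖ V u u₁ Atop Abot) (hG : Tendsto G atTop (𝓝 0)) :
    Tendsto (correctedCurrent ω ϖ E V G μ u u₁) atTop
      (𝓝 ((2 * (fi + yi) * ω ^ 2 - E * (χ₂i * ω ^ 2 + χ₁i * ϖ * ω)) * Atop)) := by
  have h := (tendsto_combinedCurrent_atTop (E := E) hl hb).add (hG.mul hb.normSq_top)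
  rw [zero_mul, add_zero] at h
  exact h

/-- `Q̃(−∞) = Q(−∞)` when `G → 0` at the horizon end. [folklore] -/
theorem tendsto_correctedCurrent_atBot (hl : μ.EndLimits atBot fh yh χ₁h χ₂h)
    (hb : OutgoingBoundary ω ϖ V u u₁ Atop Abot) (hG : Tendsto G atBot (𝓝 0)) :
    Tendsto (correctedCurrent ω ϖ E V G μ u u₁) atBot
      (𝓝 ((2 * (fh + yh) * ϖ ^ 2 + E * (χ₂h * ω * ϖ + χ₁h * ϖ ^ 2)) * Abot)) := by
  have h := (tendsto_combinedCurrent_atBot (E := E) hl hb).add (hG.mul hb.normSq_bot)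
  rw [zero_mul, add_zero] at h
  exact h

end Ends

/-! ### The integrated identity, integrability, and the estimate -/

section Estimate

variable {ω ϖ E b R₁ R₂ Atop Abot fi yi χ₁i χ₂i fh yh χ₁h χ₂h : ℝ} {V V' G G' w : ℝ → ℝ}
  {μ : Multipliers} {u u₁ u₂ H : ℝ → ℂ}

/-- `∫ correctedBulk = Q̃(∞) − Q̃(−∞) + ∫ source`. [folklore] -/
theorem integral_correctedBulk_eq {qbot qtop : ℝ} (hV : ∀ x, HasDerivAt V (V' x) x)
    (hG : ∀ x, HasDerivAt G (G' x) x) (hμ : μ.HasDerivs) (hu : ∀ x, HasDerivAt u (u₁ x) x)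
    (hu₁ : ∀ x, HasDerivAt u₁ (u₂ x) x)
    (hode : ∀ x, u₂ x + ((ω ^ 2 - V x : ℝ) : ℂ) * u x = H x)
    (hP : Integrable (correctedBulk ω ϖ E V V' G G' μ u u₁))
    (hS : Integrable (combinedSource ω ϖ E μ u u₁ H))
    (hbot : Tendsto (correctedCurrent ω ϖ E V G μ u u₁) atBot (𝓝 qbot))
    (htop : Tendsto (correctedCurrent ω ϖ E V G μ u u₁) atTop (𝓝 qtop)) :
    ∫ x, correctedBulk ω ϖ E V V' G G' μ u u₁ x =
      qtop - qbot + ∫ x, combinedSource ω ϖ E μ u u₁ H x := by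
  have hderiv := fun x ↦ hasDerivAt_correctedCurrent (ϖ := ϖ) (E := E) (hV x) (hG x) hμ (hu x)
    (hu₁ x) (hode x)
  have hI : Integrable (fun x ↦ correctedBulk ω ϖ E V V' G G' μ u u₁ x -
      combinedSource ω ϖ E μ u u₁ H x) := hP.sub hS
  have hftc := integral_of_hasDerivAt_of_tendsto hderiv hI hbot htop
  rw [integral_sub hP hS] at hftc
  linarith

/-- A non-negative corrected bulk is integrable (as `integrable_combinedBulk_of_nonneg`).
[folklore] -/
theorem integrable_correctedBulk_of_nonneg {qbot qtop : ℝ} (hV : ∀ x, HasDerivAt V (V' x) x)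
    (hG : ∀ x, HasDerivAt G (G' x) x) (hμ : μ.HasDerivs) (hu : ∀ x, HasDerivAt u (u₁ x) x)
    (hu₁ : ∀ x, HasDerivAt u₁ (u₂ x) x)
    (hode : ∀ x, u₂ x + ((ω ^ 2 - V x : ℝ) : ℂ) * u x = H x) (hH : Continuous H)
    (hS : Integrable (combinedSource ω ϖ E μ u u₁ H))
    (hbot : Tendsto (correctedCurrent ω ϖ E V G μ u u₁) atBot (𝓝 qbot))
    (htop : Tendsto (correctedCurrent ω ϖ E V G μ u u₁) atTop (𝓝 qtop))
    (hP0 : ∀ x, 0 ≤ correctedBulk ω ϖ E V V' G G' μ u u₁ x) :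
    Integrable (correctedBulk ω ϖ E V V' G G' μ u u₁) := by
  have hSc : Continuous (combinedSource ω ϖ E μ u u₁ H) :=
    continuous_combinedSource hμ hu hu₁ hH
  have hderiv : ∀ x, HasDerivAt (correctedCurrent ω ϖ E V G μ u u₁)
      (correctedBulk ω ϖ E V V' G G' μ u u₁ x + -combinedSource ω ϖ E μ u u₁ H x) x := fun x ↦ by
    simpa only [← sub_eq_add_neg] using
      hasDerivAt_correctedCurrent (ϖ := ϖ) (E := E) (hV x) (hG x) hμ (hu x) (hu₁ x) (hode x)
  exact integrable_of_hasDerivAt_add_of_nonneg hderiv hP0 hS.neg hSc.neg hbot htop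

/-- **The deduction "corrected bulk ≥ 0 pointwise, coercive on `[R₁, R₂]` ⇒ estimate"** with the
boundary contribution explicit, for `Q̃ = Q + G|u|²` with `G → 0` at both ends (then the boundary
values are those of `Q`). [cite: DafermosRodnianskiShlapentokhrothman2014, §8.2] -/
theorem corrected_estimate (hV : ∀ x, HasDerivAt V (V' x) x) (hG : ∀ x, HasDerivAt G (G' x) x)
    (hGtop : Tendsto G atTop (𝓝 0)) (hGbot : Tendsto G atBot (𝓝 0)) (hμ : μ.HasDerivs)
    (hu : ∀ x, HasDerivAt u (u₁ x) x) (hu₁ : ∀ x, HasDerivAt u₁ (u₂ x) x)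
    (hode : ∀ x, u₂ x + ((ω ^ 2 - V x : ℝ) : ℂ) * u x = H x) (hH : Continuous H)
    (hS : Integrable (combinedSource ω ϖ E μ u u₁ H))
    (hb : OutgoingBoundary ω ϖ V u u₁ Atop Abot)
    (htop : μ.EndLimits atTop fi yi χ₁i χ₂i) (hbot : μ.EndLimits atBot fh yh χ₁h χ₂h)
    (hP0 : ∀ x, 0 ≤ correctedBulk ω ϖ E V V' G G' μ u u₁ x) (hw : Continuous w) (hR : R₁ ≤ R₂)
    (hcoer : ∀ x ∈ Icc R₁ R₂,
      b * (‖u₁ x‖ ^ 2 + w x * ‖u x‖ ^ 2) ≤ correctedBulk ω ϖ E V V' G G' μ u u₁ x) :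
    b * ∫ x in R₁..R₂, (‖u₁ x‖ ^ 2 + w x * ‖u x‖ ^ 2) ≤
      (∫ x, combinedSource ω ϖ E μ u u₁ H x) +
        ((2 * (fi + yi) * ω ^ 2 - E * (χ₂i * ω ^ 2 + χ₁i * ϖ * ω)) * Atop -
          (2 * (fh + yh) * ϖ ^ 2 + E * (χ₂h * ω * ϖ + χ₁h * ϖ ^ 2)) * Abot) := by
  have hQtop := tendsto_correctedCurrent_atTop (E := E) htop hb hGtop
  have hQbot := tendsto_correctedCurrent_atBot (E := E) hbot hb hGbot
  have hP : Integrable (correctedBulk ω ϖ E V V' G G' μ u u₁) :=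
    integrable_correctedBulk_of_nonneg hV hG hμ hu hu₁ hode hH hS hQbot hQtop hP0
  have hid := integral_correctedBulk_eq hV hG hμ hu hu₁ hode hP hS hQbot hQtop
  have huc : Continuous u := continuous_iff_continuousAt.2 fun x ↦ (hu x).continuousAt
  have hu₁c : Continuous u₁ := continuous_iff_continuousAt.2 fun x ↦ (hu₁ x).continuousAt
  have hmc : Continuous fun x ↦ b * (‖u₁ x‖ ^ 2 + w x * ‖u x‖ ^ 2) := by fun_prop
  have hle := intervalIntegral_le_integral_of_nonneg hP hP0 hmc hR hcoer
  rw [intervalIntegral.integral_const_mul] at hle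
  linarith

/-- **Corrected bulk `≥ 0` + good boundary signs ⇒ the estimate** `b∫_{R₁}^{R₂}(|u'|² + w|u|²) ≤ ∫ source`
(as `combined_estimate_of_boundary_sign`). [cite: DafermosRodnianskiShlapentokhrothman2014, §8.2] -/
theorem corrected_estimate_of_boundary_sign (hV : ∀ x, HasDerivAt V (V' x) x)
    (hG : ∀ x, HasDerivAt G (G' x) x) (hGtop : Tendsto G atTop (𝓝 0))
    (hGbot : Tendsto G atBot (𝓝 0)) (hμ : μ.HasDerivs)
    (hu : ∀ x, HasDerivAt u (u₁ x) x) (hu₁ : ∀ x, HasDerivAt u₁ (u₂ x) x)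
    (hode : ∀ x, u₂ x + ((ω ^ 2 - V x : ℝ) : ℂ) * u x = H x) (hH : Continuous H)
    (hS : Integrable (combinedSource ω ϖ E μ u u₁ H))
    (hb : OutgoingBoundary ω ϖ V u u₁ Atop Abot)
    (htop : μ.EndLimits atTop fi yi χ₁i χ₂i) (hbot : μ.EndLimits atBot fh yh χ₁h χ₂h)
    (hP0 : ∀ x, 0 ≤ correctedBulk ω ϖ E V V' G G' μ u u₁ x) (hw : Continuous w) (hR : R₁ ≤ R₂)
    (hcoer : ∀ x ∈ Icc R₁ R₂,
      b * (‖u₁ x‖ ^ 2 + w x * ‖u x‖ ^ 2) ≤ correctedBulk ω ϖ E V V' G G' μ u u₁ x)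
    (hsign_top : 2 * (fi + yi) * ω ^ 2 ≤ E * (χ₂i * ω ^ 2 + χ₁i * ϖ * ω))
    (hsign_bot : 0 ≤ 2 * (fh + yh) * ϖ ^ 2 + E * (χ₂h * ω * ϖ + χ₁h * ϖ ^ 2)) :
    b * ∫ x in R₁..R₂, (‖u₁ x‖ ^ 2 + w x * ‖u x‖ ^ 2) ≤ ∫ x, combinedSource ω ϖ E μ u u₁ H x := by
  have h := corrected_estimate hV hG hGtop hGbot hμ hu hu₁ hode hH hS hb htop hbot hP0 hw hR hcoer
  have h1 : 0 ≤ (E * (χ₂i * ω ^ 2 + χ₁i * ϖ * ω) - 2 * (fi + yi) * ω ^ 2) * Atop :=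
    mul_nonneg (sub_nonneg.2 hsign_top) hb.nonneg_top
  have h2 : 0 ≤ (2 * (fh + yh) * ϖ ^ 2 + E * (χ₂h * ω * ϖ + χ₁h * ϖ ^ 2)) * Abot :=
    mul_nonneg hsign_bot hb.nonneg_bot
  nlinarith [h1, h2]

/-- **Pointwise absorption of the cross term** (the pointwise form of (smallOmegaSecond) of DRSR
arXiv:1402.7034): if `0 ≤ p, q`, `4g² ≤ pq`, then `½(pA + qB) ≤ pA + 2gc + qB` whenever
`c² ≤ AB`, `0 ≤ A, B` (`A = |u'|²`, `B = |u|²`, `c = Re(u'ū)`, `p = ỹ'`, `q = ỹ'ω₀²`, `g = ỹṼ`).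
[folklore] -/
theorem cross_term_absorb {p q g A B c : ℝ} (hp : 0 ≤ p) (hq : 0 ≤ q) (hg : 4 * g ^ 2 ≤ p * q)
    (hA : 0 ≤ A) (hB : 0 ≤ B) (hc : c ^ 2 ≤ A * B) :
    1 / 2 * (p * A + q * B) ≤ p * A + 2 * g * c + q * B := by
  -- |2 g c| ≤ 2|g|√(AB) ≤ (p A + q B)/2 since 4g² ≤ pq
  have h1 : (2 * g * c) ^ 2 ≤ (1 / 2 * (p * A + q * B)) ^ 2 := by
    have e : (2 * g * c) ^ 2 = 4 * g ^ 2 * c ^ 2 := by ring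
    rw [e]
    have h2 : 4 * g ^ 2 * c ^ 2 ≤ p * q * (A * B) :=
      mul_le_mul hg hc (sq_nonneg c) (mul_nonneg hp hq)
    nlinarith [sq_nonneg (p * A - q * B), mul_nonneg (mul_nonneg hp hA) (mul_nonneg hq hB)]
  have h3 : 0 ≤ 1 / 2 * (p * A + q * B) := by positivity
  have h4 := abs_le_of_sq_le_sq' h1 h3
  linarith [h4.1]

end Estimate

end Kerr

end Literature.Geometry.Lorentzian
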